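import Mathlib
import HarnessLib
import Summits.HubbardSuperconductivity.HubbardSuperconductivity.Theorems.KLProgrammeC4aLevelChartImage
import Summits.HubbardSuperconductivity.HubbardSuperconductivity.Theorems.KLProgrammeC4aTadpoleJets

/-!
# Route `KLProgramme` — crux C4a, sub-lemma (L2) CAPSTONE: angular jets of a MOMENTUM-SPACE one-slice integral over the scale tube of
# the Brillouin square, read on the Fermi curve — the statement the engine-side consumer instantiates

Cell `gate-hubbard-kl`, lane hubbard-kl-c4a-1 (g2); helper for the engine-flow child `KLRegimeEngineV17F2` (stmt-HubbardSuperconductivity-20437),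
stub (C) `stub_twoLeg_curvature` (memo HOME/hubbard-kl-c4a-1/C4A-PLAN.md §2c, §6 (L2), §9, §10).

THE OBJECT, in momentum space.  At a fixed loop frequency, a one-slice tadpole contribution to the scale-`n` two-leg increment read at the
curve point `k_F^K(θ) = Φ(0, θ)` is
  `T(θ) = ∫_{q ∈ (−π,π)², |e_K(q)| < r} f(e_K(q)) · V(Φ(0,θ), q) dq`
— slice profile `f` of the LEVEL `e_K(q)` (`C^∞`, `tsupport f ⊆ (−r, r)`: the slice lives inside the tube) times the (fat) vertex `V`.
By `setIntegral_tube_eq_chart` + `setIntegral_box_shift_angle` (…C4aLevelChartImage) this is the chart-side tadpole of …C4aTadpoleJets with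
weight `W = levelChartJac μ K = u·∂_ρu` (the Jacobian, §1: smooth on the tube, `2π`-periodic), and `e_K(Φ(ρ,ϑ)) = ρ` turns `f(e_K(q))` into
`f(ρ)` — never differentiated.  Hence:

* `norm_iteratedDeriv_tubeTadpole_le` (§3): with Jacobian angular jets `≤ G_i` (hypothesis — frame tameness, next file) and co-moving jet
  dominators `a_i(ρ, ϑ_rel)` of `V` integrable on the chart box,
  `‖T⁽ʲ⁾(θ)‖ ≤ Σ_{i ≤ j} C(j,i)·G_i·∫_{(−r,r)×(0,2π]} ‖f(ρ)‖·a_{j−i}(ρ,ϑ)`, uniformly in `θ`; `contDiff_tubeTadpole`;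
* `norm_iteratedDeriv_tubeTadpole_le_of_coMovingJets` (§3): the sup form `≤ (Σ C(j,i)·G_i·A_{j−i}) · 2π · ∫_{(−r,r)} ‖f‖` under `CoMovingJets A r μ K V`.

§1 `levelChartJac` and its smoothness/periodicity; §2 the momentum-space tadpole IS the chart-side tadpole (`tubeTadpole_eq_chart`).
Pure calculus on the tree's objects; nothing is asserted about the Hubbard model (the frequency sum, the lattice-sum ↔ integral aliasing,
the Jacobian jets from frame tameness and the vertex's co-moving jets (L3) are the remaining named inputs).  References: FST II CPAM 51
(1998) 1133 Thm 3.5; FST III CPAM 52 (1999) 273 §3.6; BGM 2006 §2.4 [cite: BenfattoGiulianiMastropietro2006].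
-/

noncomputable section

namespace Summit.HubbardSuperconductivity.HubbardSuperconductivity.Theorems.C4a

set_option linter.dupNamespace false -- summit = problem name (single-conjunct summit), D-0017

open Real Set MeasureTheory Filter
open scoped ContDiff Topology
open Literature.MathematicalPhysics.QuantumLattice Literature.MathematicalPhysics.QuantumLattice.BandSectorCounting
open Summit.HubbardSuperconductivity.HubbardSuperconductivity.Theorems.DispersionFlow
open Summit.HubbardSuperconductivity.HubbardSuperconductivity.Theorems.KLRegimeSplit
open Summit.HubbardSuperconductivity.HubbardSuperconductivity.Theorems.PerturbedFermiCurve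

/-! ## §1 The Jacobian weight `u·∂_ρu` -/

/-- **The Jacobian weight of the co-moving chart**: `levelChartJac μ K (ρ, ϑ) = u_K(μ+ρ; ϑ) · ∂_μ u_K(μ+ρ; ϑ)` (= `det D levelChart`,
`det_levelChartDeriv`; positive, `≤ π√2/(Dt_min − 2A)`). -/
def levelChartJac (μ : ℝ) (K : TrigPolyC4v) (p : ℝ × ℝ) : ℝ :=
  perturbedFermiRadius (fun k : Fin 2 → ℝ => -K.eval k) (μ + p.1) p.2 *
    deriv (fun m : ℝ => perturbedFermiRadius (fun k : Fin 2 → ℝ => -K.eval k) m p.2) (μ + p.1)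

/-- Unfolding. -/
theorem levelChartJac_apply (μ : ℝ) (K : TrigPolyC4v) (p : ℝ × ℝ) :
    levelChartJac μ K p = perturbedFermiRadius (fun k : Fin 2 → ℝ => -K.eval k) (μ + p.1) p.2 *
      deriv (fun m : ℝ => perturbedFermiRadius (fun k : Fin 2 → ℝ => -K.eval k) m p.2) (μ + p.1) := rfl

/-- The Jacobian weight is `2π`-periodic in the angle. -/
theorem levelChartJac_periodic (μ : ℝ) (K : TrigPolyC4v) (ρ : ℝ) :
    Function.Periodic (fun ϑ => levelChartJac μ K (ρ, ϑ)) (2 * π) := by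
  intro ϑ
  simp only [levelChartJac, perturbedFermiRadius_add_two_pi]

/-- The chart is `2π`-periodic in the angle. -/
theorem levelChart_periodic (μ : ℝ) (K : TrigPolyC4v) (ρ : ℝ) :
    Function.Periodic (fun ϑ => levelChart μ K (ρ, ϑ)) (2 * π) := by
  intro ϑ
  simp only [levelChart_apply, perturbedFermiRadius_add_two_pi, Real.cos_add_two_pi, Real.sin_add_two_pi]

section Smooth

variable {a b : ℝ} (B : BandBounds a b) {K : TrigPolyC4v} {A : ℝ}
  (hA : ∀ p : Momentum, ∀ j ≤ 2, ‖iteratedFDeriv ℝ j (frameShift K) p‖ ≤ A) (hADt : 2 * A < B.Dtmin)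
  {μ r : ℝ} (hlo : a < μ - r - A) (hhi : μ + r + A < b)
include B hA hADt hlo hhi

/-- The radial function `(ρ, ϑ) ↦ u_K(μ+ρ; ϑ)` is `C^∞` on the open tube `{|ρ| < r} × ℝ`. -/
theorem contDiffOn_levelRadius_tube :
    ContDiffOn ℝ ∞ (fun p : ℝ × ℝ => perturbedFermiRadius (fun k : Fin 2 → ℝ => -K.eval k) (μ + p.1) p.2)
      ({ρ : ℝ | |ρ| < r} ×ˢ univ) := by
  intro p hp
  have hρ : |p.1| < r := (mem_prod.1 hp).1
  have h1 : a < μ + p.1 - A := by have := (abs_lt.1 hρ).1; linarith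
  have h2 : μ + p.1 + A < b := by have := (abs_lt.1 hρ).2; linarith
  exact (contDiffAt_levelRadius B hA hADt (μ := μ) (ρ₀ := p.1) h1 h2 (m := ⊤) p.2).contDiffWithinAt

/-- **The Jacobian weight is `C^∞` on the open tube** (product of the radius and of the radial partial `D u (1,0)`, both smooth). -/
theorem contDiffOn_levelChartJac : ContDiffOn ℝ ∞ (levelChartJac μ K) ({ρ : ℝ | |ρ| < r} ×ˢ univ) := by
  have hT : IsOpen ({ρ : ℝ | |ρ| < r} ×ˢ (univ : Set ℝ)) := (isOpen_lt continuous_abs continuous_const).prod isOpen_univ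
  have hU := contDiffOn_levelRadius_tube B hA hADt hlo hhi
  have hD : ContDiffOn ℝ ∞
      (fun p : ℝ × ℝ => fderiv ℝ (fun q : ℝ × ℝ => perturbedFermiRadius (fun k : Fin 2 → ℝ => -K.eval k) (μ + q.1) q.2) p
        ((1 : ℝ), (0 : ℝ))) ({ρ : ℝ | |ρ| < r} ×ˢ univ) :=
    (hU.fderiv_of_isOpen hT (by simp)).clm_apply contDiffOn_const
  refine (hU.mul hD).congr fun p hp => ?_
  have hρ : |p.1| < r := (mem_prod.1 hp).1
  have h1 : a < μ + p.1 - A := by have := (abs_lt.1 hρ).1; linarith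
  have h2 : μ + p.1 + A < b := by have := (abs_lt.1 hρ).2; linarith
  rw [levelChartJac_apply, ← fderiv_levelRadius_apply_one_zero B hA hADt h1 h2]

/-- The chart `(ρ, ϑ) ↦ levelPoint μ K ρ ϑ` composed into a jointly smooth two-momentum kernel: the chart-side vertex factor
`p ↦ V(Φ(0,θ), Φ(ρ,ϑ))` is `C^∞` on the open tube (for the continuity/integrability bookkeeping of §2). -/
theorem contDiffOn_vertex_chart {V : Momentum → Momentum → ℂ} (hV : ContDiff ℝ ∞ fun x : Momentum × Momentum => V x.1 x.2)
    (θ : ℝ) :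
    ContDiffOn ℝ ∞ (fun p : ℝ × ℝ => V (levelPoint μ K 0 θ) (levelPoint μ K p.1 p.2)) ({ρ : ℝ | |ρ| < r} ×ˢ univ) := by
  have hΦ : ContDiffOn ℝ ∞ (fun p : ℝ × ℝ => levelPoint μ K p.1 p.2) ({ρ : ℝ | |ρ| < r} ×ˢ univ) :=
    contDiffOn_levelPoint B hA hADt hlo hhi
  have hpair : ContDiffOn ℝ ∞ (fun p : ℝ × ℝ => ((levelPoint μ K 0 θ : Momentum), levelPoint μ K p.1 p.2))
      ({ρ : ℝ | |ρ| < r} ×ˢ univ) := contDiffOn_const.prodMk hΦ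
  exact hV.comp_contDiffOn hpair

end Smooth

/-! ## §2 The momentum-space tube tadpole IS the chart-side tadpole -/

section Chart

variable {a b : ℝ} (B : BandBounds a b) {K : TrigPolyC4v} {A : ℝ}
  (hA : ∀ p : Momentum, ∀ j ≤ 2, ‖iteratedFDeriv ℝ j (frameShift K) p‖ ≤ A) (hADt : 2 * A < B.Dtmin)
  {μ r : ℝ} (hr : 0 < r) (hlo : a < μ - r - A) (hhi : μ + r + A < b)
include B hA hADt hr hlo hhi

omit hr in
/-- **Global continuity of the chart-side integrand** `p ↦ f(ρ)·(J(p) • V(Φ(0,θ), Φ(ρ,ϑ)))`: continuous on the open tube, locally zero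
off it (`tsupport f ⊆ (−r, r)`). -/
theorem continuous_chartIntegrand {f : ℝ → ℂ} (hf : ContDiff ℝ ∞ f) (hfsupp : tsupport f ⊆ Ioo (-r) r)
    {V : Momentum → Momentum → ℂ} (hV : ContDiff ℝ ∞ fun x : Momentum × Momentum => V x.1 x.2) (θ : ℝ) :
    Continuous fun p : ℝ × ℝ => f p.1 * (levelChartJac μ K p • V (levelPoint μ K 0 θ) (levelPoint μ K p.1 p.2)) := by
  set U : Set (ℝ × ℝ) := {ρ : ℝ | |ρ| < r} ×ˢ univ with hU
  have hUo : IsOpen U := (isOpen_lt continuous_abs continuous_const).prod isOpen_univ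
  have hon : ContDiffOn ℝ 0 (fun p : ℝ × ℝ => f p.1 * (levelChartJac μ K p • V (levelPoint μ K 0 θ) (levelPoint μ K p.1 p.2))) U :=
    ((hf.comp contDiff_fst).contDiffOn.of_le (by simp)).mul
      (((contDiffOn_levelChartJac B hA hADt hlo hhi).of_le (by simp)).smul
        ((contDiffOn_vertex_chart B hA hADt hlo hhi hV θ).of_le (by simp)))
  have hoff : ∀ p ∉ U, (fun p : ℝ × ℝ => f p.1 * (levelChartJac μ K p • V (levelPoint μ K 0 θ) (levelPoint μ K p.1 p.2))) =ᶠ[𝓝 p] 0 := by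
    intro p hp
    have hρ : p.1 ∉ tsupport f := fun h => hp (by
      have h' := hfsupp h
      exact mk_mem_prod (abs_lt.2 ⟨h'.1, h'.2⟩) (mem_univ _))
    have hev : f =ᶠ[𝓝 p.1] 0 := notMem_tsupport_iff_eventuallyEq.mp hρ
    have hev' : ∀ᶠ q in 𝓝 p, f q.1 = 0 := continuous_fst.continuousAt.eventually hev
    filter_upwards [hev'] with q hq
    simp only [hq, zero_mul, Pi.zero_apply]
  exact contDiff_zero.mp (contDiff_of_contDiffOn_of_eventuallyEq_zero hUo hon hoff)

omit hr in
/-- **The momentum-space tube tadpole is the chart-side tadpole of `…C4aTadpoleJets`**: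
`∫_{|q₁|,|q₂|<π, |e_K(q)|<r} f(e_K(q))·V(Φ(0,θ), q) dq = ∫_{(ρ,ϑ)∈(−r,r)×(0,2π]} f(ρ)·(J(ρ,ϑ) • V(Φ(0,θ), Φ(ρ,ϑ)))`. -/
theorem tubeTadpole_eq_chart {f : ℝ → ℂ} (hf : ContDiff ℝ ∞ f) (hfsupp : tsupport f ⊆ Ioo (-r) r)
    {V : Momentum → Momentum → ℂ} (hV : ContDiff ℝ ∞ fun x : Momentum × Momentum => V x.1 x.2) (θ : ℝ) :
    ∫ q in {q : ℝ × ℝ | |q.1| < π ∧ |q.2| < π ∧ |frameLevel μ K (WithLp.toLp 2 ![q.1, q.2])| < r},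
        f (frameLevel μ K (WithLp.toLp 2 ![q.1, q.2])) * V (levelPoint μ K 0 θ) (WithLp.toLp 2 ![q.1, q.2]) =
      ∫ p in Ioo (-r) r ×ˢ Ioc 0 (2 * π), f p.1 * (levelChartJac μ K p • V (levelPoint μ K 0 θ) (levelPoint μ K p.1 p.2)) := by
  rw [setIntegral_tube_eq_chart B hA hADt hlo hhi]
  -- on the box the integrand reads f(ρ)·(J • V(Φ(0,θ), Φ(ρ,ϑ)))
  have hbox : ∀ p ∈ Ioo (-r) r ×ˢ Ioc (-π) π,
      (perturbedFermiRadius (fun k : Fin 2 → ℝ => -K.eval k) (μ + p.1) p.2 *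
          deriv (fun m : ℝ => perturbedFermiRadius (fun k : Fin 2 → ℝ => -K.eval k) m p.2) (μ + p.1)) •
        (f (frameLevel μ K (WithLp.toLp 2 ![(levelChart μ K p).1, (levelChart μ K p).2])) *
          V (levelPoint μ K 0 θ) (WithLp.toLp 2 ![(levelChart μ K p).1, (levelChart μ K p).2])) =
      f p.1 * (levelChartJac μ K p • V (levelPoint μ K 0 θ) (levelPoint μ K p.1 p.2)) := by
    intro p hp
    have hp1 : p.1 ∈ Ioo (-r) r := (mem_prod.1 hp).1
    have h1 : a ≤ μ + p.1 - A := by linarith [hp1.1]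
    have h2 : μ + p.1 + A ≤ b := by linarith [hp1.2]
    rw [toLp_vec_levelChart, frameLevel_levelPoint B hA h1 h2, ← levelChartJac_apply, mul_smul_comm]
  rw [setIntegral_congr_fun (measurableSet_Ioo.prod measurableSet_Ioc) hbox]
  -- shift the angular window
  have hcont := continuous_chartIntegrand B hA hADt hlo hhi hf hfsupp hV θ
  have hper : ∀ ρ, Function.Periodic
      (fun ϑ => f (ρ, ϑ).1 * (levelChartJac μ K (ρ, ϑ) • V (levelPoint μ K 0 θ) (levelPoint μ K (ρ, ϑ).1 (ρ, ϑ).2))) (2 * π) := by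
    intro ρ ϑ
    simp only [levelChartJac_periodic μ K ρ ϑ, levelPoint_periodic μ K ρ ϑ]
  have hK : ∀ s t : ℝ, IntegrableOn
      (fun p : ℝ × ℝ => f p.1 * (levelChartJac μ K p • V (levelPoint μ K 0 θ) (levelPoint μ K p.1 p.2))) (Ioo (-r) r ×ˢ Ioc s t) :=
    fun s t => (hcont.continuousOn.integrableOn_compact (isCompact_Icc.prod isCompact_Icc)).mono_set
      (prod_mono Ioo_subset_Icc_self Ioc_subset_Icc_self)
  exact setIntegral_box_shift_angle hper (hK _ _) (hK _ _)

end Chart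

/-! ## §3 The tube tadpole-jet theorem -/

section Jets

variable {a b : ℝ} (B : BandBounds a b) {K : TrigPolyC4v} {A : ℝ}
  (hA : ∀ p : Momentum, ∀ j ≤ 2, ‖iteratedFDeriv ℝ j (frameShift K) p‖ ≤ A) (hADt : 2 * A < B.Dtmin)
  {μ r : ℝ} (hr : 0 < r) (hlo : a < μ - r - A) (hhi : μ + r + A < b)
include B hA hADt hr hlo hhi

/-- **THE TUBE TADPOLE-JET THEOREM (momentum space, pointwise co-moving dominators).**  Slice profile `f` of the level (`C^∞`,
`tsupport f ⊆ (−r,r)`), Jacobian angular jets `‖∂_ϑⁱ J(ρ,·)‖ ≤ G i` (`i ≤ N`) on the tube, vertex `V` jointly `C^∞` with co-moving jet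
dominators `‖∂ₜⁱ coMoving μ K V θ ρ (ϑ+θ)|₀‖ ≤ a_i(ρ,ϑ)` integrable on the chart box.  Then for `j ≤ N`, uniformly in `θ`:
`‖∂_θʲ ∫_{|q₁|,|q₂|<π, |e_K(q)|<r} f(e_K q)·V(Φ(0,θ), q) dq‖ ≤ Σ_{i≤j} C(j,i)·G_i·∫_{(−r,r)×(0,2π]} ‖f(ρ)‖·a_{j−i}(ρ,ϑ)`. -/
theorem norm_iteratedDeriv_tubeTadpole_le {f : ℝ → ℂ} (hf : ContDiff ℝ ∞ f) (hfsupp : tsupport f ⊆ Ioo (-r) r)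
    {N : ℕ} {G : ℕ → ℝ} (hJjet : ∀ ρ, |ρ| < r → ∀ i ≤ N, ∀ s, ‖iteratedDeriv i (fun s => levelChartJac μ K (ρ, s)) s‖ ≤ G i)
    {V : Momentum → Momentum → ℂ} (hV : ContDiff ℝ ∞ fun x : Momentum × Momentum => V x.1 x.2)
    {aV : ℕ → ℝ × ℝ → ℝ} (haV : ∀ i ≤ N, IntegrableOn (aV i) (Ioo (-r) r ×ˢ Ioc 0 (2 * π)))
    (hVjet : ∀ θ ρ ϑ, |ρ| < r → ∀ i ≤ N, ‖iteratedDeriv i (coMoving μ K V θ ρ (ϑ + θ)) 0‖ ≤ aV i (ρ, ϑ))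
    {j : ℕ} (hj : j ≤ N) (θ : ℝ) :
    ‖iteratedDeriv j (fun θ : ℝ =>
        ∫ q in {q : ℝ × ℝ | |q.1| < π ∧ |q.2| < π ∧ |frameLevel μ K (WithLp.toLp 2 ![q.1, q.2])| < r},
          f (frameLevel μ K (WithLp.toLp 2 ![q.1, q.2])) * V (levelPoint μ K 0 θ) (WithLp.toLp 2 ![q.1, q.2])) θ‖ ≤
      ∑ i ∈ Finset.range (j + 1), (j.choose i : ℝ) * G i *
        ∫ a in Ioo (-r) r ×ˢ Ioc 0 (2 * π), ‖f a.1‖ * aV (j - i) a := by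
  have hfun : (fun θ : ℝ =>
        ∫ q in {q : ℝ × ℝ | |q.1| < π ∧ |q.2| < π ∧ |frameLevel μ K (WithLp.toLp 2 ![q.1, q.2])| < r},
          f (frameLevel μ K (WithLp.toLp 2 ![q.1, q.2])) * V (levelPoint μ K 0 θ) (WithLp.toLp 2 ![q.1, q.2])) =
      fun θ : ℝ => ∫ a in Ioo (-r) r ×ˢ Ioc 0 (2 * π),
        (fun p : ℝ × (ℝ × ℝ) => f p.2.1 * (levelChartJac μ K p.2 • (fun (_ : ℝ) (k q : Momentum) => V k q) p.2.1
          (levelPoint μ K 0 p.1) (levelPoint μ K p.2.1 p.2.2))) (θ, a) :=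
    funext fun θ' => tubeTadpole_eq_chart B hA hADt hlo hhi hf hfsupp hV θ'
  rw [hfun]
  have hV' : ContDiff ℝ ∞ fun x : ℝ × Momentum × Momentum => (fun (_ : ℝ) (k q : Momentum) => V k q) x.1 x.2.1 x.2.2 :=
    hV.comp contDiff_snd
  exact norm_iteratedDeriv_tadpole_le B hA hADt hr hlo hhi hf hfsupp (contDiffOn_levelChartJac B hA hADt hlo hhi)
    (levelChartJac_periodic μ K) hJjet (V := fun (_ : ℝ) (k q : Momentum) => V k q) hV' haV
    (fun θ ρ ϑ hρ i hi => hVjet θ ρ ϑ hρ i hi) rfl hj θ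

/-- **The tube tadpole is `C^∞` in the external angle.** -/
theorem contDiff_tubeTadpole {f : ℝ → ℂ} (hf : ContDiff ℝ ∞ f) (hfsupp : tsupport f ⊆ Ioo (-r) r)
    {V : Momentum → Momentum → ℂ} (hV : ContDiff ℝ ∞ fun x : Momentum × Momentum => V x.1 x.2) :
    ContDiff ℝ ∞ (fun θ : ℝ =>
      ∫ q in {q : ℝ × ℝ | |q.1| < π ∧ |q.2| < π ∧ |frameLevel μ K (WithLp.toLp 2 ![q.1, q.2])| < r},
        f (frameLevel μ K (WithLp.toLp 2 ![q.1, q.2])) * V (levelPoint μ K 0 θ) (WithLp.toLp 2 ![q.1, q.2])) := by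
  have hfun : (fun θ : ℝ =>
        ∫ q in {q : ℝ × ℝ | |q.1| < π ∧ |q.2| < π ∧ |frameLevel μ K (WithLp.toLp 2 ![q.1, q.2])| < r},
          f (frameLevel μ K (WithLp.toLp 2 ![q.1, q.2])) * V (levelPoint μ K 0 θ) (WithLp.toLp 2 ![q.1, q.2])) =
      fun θ : ℝ => ∫ a in Ioo (-r) r ×ˢ Ioc 0 (2 * π),
        (fun p : ℝ × (ℝ × ℝ) => f p.2.1 * (levelChartJac μ K p.2 • (fun (_ : ℝ) (k q : Momentum) => V k q) p.2.1
          (levelPoint μ K 0 p.1) (levelPoint μ K p.2.1 p.2.2))) (θ, a) :=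
    funext fun θ' => tubeTadpole_eq_chart B hA hADt hlo hhi hf hfsupp hV θ'
  rw [hfun]
  have hV' : ContDiff ℝ ∞ fun x : ℝ × Momentum × Momentum => (fun (_ : ℝ) (k q : Momentum) => V k q) x.1 x.2.1 x.2.2 :=
    hV.comp contDiff_snd
  exact contDiff_tadpole B hA hADt hr hlo hhi hf hfsupp (contDiffOn_levelChartJac B hA hADt hlo hhi) (levelChartJac_periodic μ K)
    (V := fun (_ : ℝ) (k q : Momentum) => V k q) hV' rfl

/-- **THE TUBE TADPOLE-JET THEOREM, sup form.**  Under `CoMovingJets Av r μ K V` (…C4aInvariantDefs §3) and Jacobian jets `≤ G_i`, for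
`j ≤ 4`: `‖∂_θʲ T(θ)‖ ≤ (Σ_{i≤j} C(j,i)·G_i·Av_{j−i}) · 2π · ∫_{(−r,r)} ‖f‖` — jet constants × slice MASS. -/
theorem norm_iteratedDeriv_tubeTadpole_le_of_coMovingJets {f : ℝ → ℂ} (hf : ContDiff ℝ ∞ f) (hfsupp : tsupport f ⊆ Ioo (-r) r)
    {G : ℕ → ℝ} (hJjet : ∀ ρ, |ρ| < r → ∀ i ≤ 4, ∀ s, ‖iteratedDeriv i (fun s => levelChartJac μ K (ρ, s)) s‖ ≤ G i)
    {V : Momentum → Momentum → ℂ} (hV : ContDiff ℝ ∞ fun x : Momentum × Momentum => V x.1 x.2)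
    {Av : ℕ → ℝ} (hVJ : CoMovingJets Av r μ K V) {j : ℕ} (hj : j ≤ 4) (θ : ℝ) :
    ‖iteratedDeriv j (fun θ : ℝ =>
        ∫ q in {q : ℝ × ℝ | |q.1| < π ∧ |q.2| < π ∧ |frameLevel μ K (WithLp.toLp 2 ![q.1, q.2])| < r},
          f (frameLevel μ K (WithLp.toLp 2 ![q.1, q.2])) * V (levelPoint μ K 0 θ) (WithLp.toLp 2 ![q.1, q.2])) θ‖ ≤
      (∑ i ∈ Finset.range (j + 1), (j.choose i : ℝ) * G i * Av (j - i)) * ((2 * π) * ∫ ρ in Ioo (-r) r, ‖f ρ‖) := by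
  have hfun : (fun θ : ℝ =>
        ∫ q in {q : ℝ × ℝ | |q.1| < π ∧ |q.2| < π ∧ |frameLevel μ K (WithLp.toLp 2 ![q.1, q.2])| < r},
          f (frameLevel μ K (WithLp.toLp 2 ![q.1, q.2])) * V (levelPoint μ K 0 θ) (WithLp.toLp 2 ![q.1, q.2])) =
      fun θ : ℝ => ∫ a in Ioo (-r) r ×ˢ Ioc 0 (2 * π),
        (fun p : ℝ × (ℝ × ℝ) => f p.2.1 * (levelChartJac μ K p.2 • (fun (_ : ℝ) (k q : Momentum) => V k q) p.2.1
          (levelPoint μ K 0 p.1) (levelPoint μ K p.2.1 p.2.2))) (θ, a) :=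
    funext fun θ' => tubeTadpole_eq_chart B hA hADt hlo hhi hf hfsupp hV θ'
  rw [hfun]
  have hV' : ContDiff ℝ ∞ fun x : ℝ × Momentum × Momentum => (fun (_ : ℝ) (k q : Momentum) => V k q) x.1 x.2.1 x.2.2 :=
    hV.comp contDiff_snd
  exact norm_iteratedDeriv_tadpole_le_of_coMovingJets B hA hADt hr hlo hhi hf hfsupp (contDiffOn_levelChartJac B hA hADt hlo hhi)
    (levelChartJac_periodic μ K) hJjet (V := fun (_ : ℝ) (k q : Momentum) => V k q) hV' (fun _ _ => hVJ) rfl hj θ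

end Jets

end Summit.HubbardSuperconductivity.HubbardSuperconductivity.Theorems.C4a
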